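import Summits.Ventures.CertifiedManyBodySolver.Downfold.EmeryMonotoneVertexFloors
import Summits.Ventures.CertifiedManyBodySolver.Downfold.EmeryBoxesLa214V122
import Literature.MathematicalPhysics.QuantumLattice.WeightedOpenClusterUniformWeightsPeriodic
import Literature.MathematicalPhysics.QuantumLattice.EmeryThreeBandCuO4WindowFloor
import HarnessLib

/-!
# The cluster-floor seam: FOUR Cu–O cluster certificates at the lower-face corners of a delivered Emery six-box
# give the typed `energyFloor` word on the whole box — and the ORDER SHEET for La₂CuO₄ (`emeryBoxLa214v122`)

Venture CertifiedManyBodySolver, cell `pub/hubbard-downfold` (stage S1 = ROUTER), seat hubbard-downfold-mod-4 (S1/S2 Emery seam);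
namespace `Summit.Ventures.CertifiedManyBodySolver.Downfold`. The typed three-band (3BE) companions of the router's boxes
(`Downfold/EmeryBoxes*`) take their energy words through the doors of `Downfold.S2SeamEmery` / `Downfold.EmeryMonotoneVertexFloors`:
a floor `m ≤ emeryEnergyDensity (emeryLine s v) ρ` certified at the vertices of the delivered six-box
`(t_pd, t_pp, ε_d, ε_p, U_d, U_p) ∈ Set.Icc lo hi` — by `holdsOn_emeryEnergyFloor_lowerFace` only at the FOUR lower-face corners
`(t_pd, t_pp) ∈ {lo₀, hi₀} × {lo₁, hi₁}`, `(ε_d, ε_p, U_d, U_p) = (lo₂, lo₃, lo₄, lo₅)` — is a box word. Until 2026-08-28 no producer of such a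
floor existed. hubbard-box-p1's `EmeryThreeBandClusterFloor` + `WeightedOpenClusterUniformWeightsPeriodic` now give the producer:
ONE operator certificate `H^{w}_B[emeryInteraction θ] + G − q₀·1 ⪰ 0` on a finite Cu–O window `B` (uniform `(2ℤ)²`-weight of mass `M`,
`G` killed by `2×2`-periodic states) yields `q₀/(4M) ≤ emeryEnergyDensity θ ρ` (`le_emeryEnergyDensity_of_posSemidef_uniform`; general
admissible weights: `le_emeryEnergyDensity_of_posSemidef_reweight`). THIS FILE is the composition, i.e. the S1 → S2 order form for a 3BE floor:

* §1 `lowerCorner lo hi : Fin 4 → (Fin 6 → ℝ)` — the four lower-face corners BY INDEX (`0 = (lo₀, lo₁, …)`, `1 = (hi₀, lo₁, …)`,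
  `2 = (lo₀, hi₁, …)`, `3 = (hi₀, hi₁, …)`, tails at `lo`); `lowerCorner_mem_piFinset_lowerFace` / `forall_mem_piFinset_lowerFace` /
  `mem_piFinset_lowerFace_iff` — the vertex set of the lower face `Set.Icc lo (lowerFace lo hi)` used by the doors IS these four points;
  `le_emeryEnergyDensity_line_of_lowerCorners`, `holdsOn_emeryEnergyFloor_of_lowerCorners` — four corner floors bind the box / the typed box.
* §2 THE COMPOSED DOOR: `le_emeryEnergyDensity_line_of_cornerCertificates` (uniform weight), `…_reweight` (any admissible weight) — four
  cluster certificates `q₀ i` at `θ_i = emeryLine s (lowerCorner lo hi i)` on one window ⇒ `m ≤ e(emeryLine s q, ρ)` on all of `Set.Icc lo hi`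
  for every `m ≤ min_i q₀ i /(4M)`; **`holdsOn_emeryEnergyFloor_of_cornerCertificates`** — the same as the `HoldsOn` word of a typed `EmeryBox`
  through the seam `emeryLineCoords εp` (entries `t_pd, t_pp, Delta_pd, U_dd, U_pp`).
* §3 ORDER SHEET for box #18 La₂CuO₄ (`emeryBoxLa214v122`, §OF-RECORD v1.22, `εp = 0`): `la214v122Corner` = the four six-vectors
  `(129/100 | 38/25, 23/50 | 33/50, 17/10, 0, 483/100, 17/5)` (proved equal to `lowerCorner` of the delivered box),
  **`emeryBoxLa214v122_energyFloor_of_cornerCertificates`** — four certificates at `emeryLine s (la214v122Corner i)` ⇒ the floor word on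
  `emeryBoxLa214v122` (cell filling of record `ρ = 5/4`, `emeryBoxLa214v122_cellFilling`), and `emeryBoxLa214v122_energyFloor_of_lowerCorners`
  (device-free form: four corner floors, however obtained).
* §4 (appended) DENSITY-RESOLVED form — the filling enters through the couplings: a certificate at the μ-TILTED point `θ + μ·levelDir`
  gives `q₀/(4M) − μρ ≤ e(θ, ρ)` (`le_emeryEnergyDensity_of_posSemidef_uniform_levelShift`, by `emeryEnergyDensity_add_levelShift` of
  `EmeryReferenceLevel`); `le_emeryEnergyDensity_line_of_tiltedCornerCertificates`, **`holdsOn_emeryEnergyFloor_of_tiltedCornerCertificates`**,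
  `emeryBoxLa214v122_energyFloor_of_tiltedCornerCertificates` — four certificates, each at its own tilt `μ i`, bind the box / the typed box / La₂CuO₄.
* §5 (appended) TURNKEY ON THE `CuO₄` PLUS WINDOW (`EmeryThreeBandCuO4WindowFloor`, this seat: the 5-site window `emeryCuO4Window` — Fock dimension
  `4⁵`, largest spin sector `100` — discharges the covering hypothesis `hfit` for every `θ`): **`holdsOn_emeryEnergyFloor_of_cuO4Certificates`** and
  **`emeryBoxLa214v122_energyFloor_of_cuO4Certificates`** — four (tilted) certificates on `emeryCuO4Window` ⇒ the typed word, NO side condition left but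
  the certificates and the nonempty class.

Everything is PROVED (0 sorry); definitions with bodies: `lowerCorner`, `la214v122Corner`. HONEST SCOPE: a composition of doors — it certifies
nothing by itself (the four `PosSemidef` hypotheses are what a kernel / interval cluster device asserts; `(emeryStates ρ).Nonempty` and the window's
covering hypothesis `hfit` stay hypotheses, the latter θ-uniform as a shape lemma delivers it); SCREENING-GRADE box ends ([float] literature with locators
in `router/BOXES/La2CuO4-family.md`); no number about the material; words of record unchanged.

## Tree search

REUSED: `lowerFace`, `le_emeryEnergyDensity_line_of_lowerFace`, `holdsOn_emeryEnergyFloor_lowerFace` (`EmeryMonotoneVertexFloors`); `emeryLo/emeryHi`,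
`emeryLineCoords`, `holdsOn_of_forall_emeryLineBox` (`S2SeamEmery`); `le_emeryEnergyDensity_of_posSemidef_uniform`, `uniformPeriodicWeight`
(`WeightedOpenClusterUniformWeightsPeriodic`); `le_emeryEnergyDensity_of_posSemidef_reweight`, `emeryInteraction` (`EmeryThreeBandClusterFloor`);
`emeryBoxLa214v122`, `la214v122_emeryLo/Hi`, `emeryBoxLa214v122_energyFloor` (`EmeryBoxesLa214V122`). `lean search 'lowerCorner|cornerCertificates'`
(2026-08-28): nothing.
-/

noncomputable section

namespace Summit.Ventures.CertifiedManyBodySolver.Downfold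

open Matrix Finset Literature.Probability.LatticeModels
open Literature.MathematicalPhysics.QuantumLattice Literature.Computation.Certificates
open scoped BigOperators ComplexOrder

/-! ## §1 The four lower-face corners, by index -/

/-- **The four lower-face corners of a six-box** `Set.Icc lo hi` in S2's order `(t_pd, t_pp, ε_d, ε_p, U_d, U_p)`, indexed by
`Fin 4` = the `(t_pd, t_pp)` end pattern `(lo,lo), (hi,lo), (lo,hi), (hi,hi)`, with `(ε_d, ε_p, U_d, U_p)` at their LOWER ends. [folklore] -/
def lowerCorner (lo hi : Fin 6 → ℝ) : Fin 4 → Fin 6 → ℝ :=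
  ![![lo 0, lo 1, lo 2, lo 3, lo 4, lo 5], ![hi 0, lo 1, lo 2, lo 3, lo 4, lo 5],
    ![lo 0, hi 1, lo 2, lo 3, lo 4, lo 5], ![hi 0, hi 1, lo 2, lo 3, lo 4, lo 5]]

/-- Each indexed corner is a vertex of the lower face `Set.Icc lo (lowerFace lo hi)` (the vertex set the doors quantify over). [folklore] -/
theorem lowerCorner_mem_piFinset_lowerFace (lo hi : Fin 6 → ℝ) (i : Fin 4) :
    lowerCorner lo hi i ∈ Fintype.piFinset (fun k => ({lo k, lowerFace lo hi k} : Finset ℝ)) := by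
  rw [Fintype.mem_piFinset]
  intro k
  fin_cases i <;> fin_cases k <;> simp [lowerCorner, lowerFace]

/-- **Four corners exhaust the lower-face vertices**: a property checked at `lowerCorner lo hi i`, `i : Fin 4`, holds at every vertex of
`Set.Icc lo (lowerFace lo hi)`. [folklore] -/
theorem forall_mem_piFinset_lowerFace {lo hi : Fin 6 → ℝ} {P : (Fin 6 → ℝ) → Prop} (h : ∀ i : Fin 4, P (lowerCorner lo hi i)) :
    ∀ v ∈ Fintype.piFinset (fun k => ({lo k, lowerFace lo hi k} : Finset ℝ)), P v := by
  intro v hv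
  rw [Fintype.mem_piFinset] at hv
  have h0 : v 0 = lo 0 ∨ v 0 = hi 0 := by simpa [lowerFace] using hv 0
  have h1 : v 1 = lo 1 ∨ v 1 = hi 1 := by simpa [lowerFace] using hv 1
  have h2 : v 2 = lo 2 := by simpa [lowerFace] using hv 2
  have h3 : v 3 = lo 3 := by simpa [lowerFace] using hv 3
  have h4 : v 4 = lo 4 := by simpa [lowerFace] using hv 4
  have h5 : v 5 = lo 5 := by simpa [lowerFace] using hv 5
  have key : ∀ i : Fin 4, v 0 = lowerCorner lo hi i 0 → v 1 = lowerCorner lo hi i 1 → P v := by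
    intro i e0 e1
    have hv' : v = lowerCorner lo hi i := by
      ext k
      fin_cases k
      · exact e0
      · exact e1
      all_goals fin_cases i <;> simp [lowerCorner, h2, h3, h4, h5]
    rw [hv']
    exact h i
  rcases h0 with e0 | e0 <;> rcases h1 with e1 | e1
  · exact key 0 (by simp [lowerCorner, e0]) (by simp [lowerCorner, e1])
  · exact key 2 (by simp [lowerCorner, e0]) (by simp [lowerCorner, e1])
  · exact key 1 (by simp [lowerCorner, e0]) (by simp [lowerCorner, e1])
  · exact key 3 (by simp [lowerCorner, e0]) (by simp [lowerCorner, e1])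

/-- The vertex set of the lower face IS the four indexed corners. [folklore] -/
theorem mem_piFinset_lowerFace_iff {lo hi v : Fin 6 → ℝ} :
    v ∈ Fintype.piFinset (fun k => ({lo k, lowerFace lo hi k} : Finset ℝ)) ↔ ∃ i : Fin 4, v = lowerCorner lo hi i :=
  ⟨fun hv => forall_mem_piFinset_lowerFace (P := fun w => ∃ i : Fin 4, w = lowerCorner lo hi i) (fun i => ⟨i, rfl⟩) v hv,
    fun ⟨i, hi'⟩ => hi' ▸ lowerCorner_mem_piFinset_lowerFace lo hi i⟩

/-- **Four corner floors bind the six-box.** Floors `m ≤ e(emeryLine s (lowerCorner lo hi i), ρ)`, `i : Fin 4`, give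
`m ≤ e(emeryLine s q, ρ)` on all of `Set.Icc lo hi` (concavity in `(t_pd, t_pp)` on the face, monotonicity in the four tail coordinates).
[cite: Israel1979, Thm. I.3.4] -/
theorem le_emeryEnergyDensity_line_of_lowerCorners (s : Fin 4 → ℝ) (ρ : ℝ) (lo hi : Fin 6 → ℝ) {m : ℝ}
    (hm : ∀ i : Fin 4, m ≤ emeryEnergyDensity (emeryLine s (lowerCorner lo hi i)) ρ)
    {q : Fin 6 → ℝ} (hq : q ∈ Set.Icc lo hi) : m ≤ emeryEnergyDensity (emeryLine s q) ρ :=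
  le_emeryEnergyDensity_line_of_lowerFace s ρ lo hi (forall_mem_piFinset_lowerFace (P := fun v => m ≤ emeryEnergyDensity (emeryLine s v) ρ) hm) hq

/-- **Four corner floors are a box word of a typed Emery box** (through the seam `emeryLineCoords εp`): floors at
`lowerCorner (emeryLo εp …) (emeryHi εp …) i`, `i : Fin 4`, give `m ≤ e(emeryLine s (emeryLineCoords εp p), ρ)` for every parameter vector `p` of `E`.
[cite: Israel1979, Thm. I.3.4] -/
theorem holdsOn_emeryEnergyFloor_of_lowerCorners {E : EmeryBox} {eA eB eD eUd eUp : Entry} {εp : ℚ}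
    (hA : E .tpd = some eA) (hB : E .tpp = some eB) (hD : E .DeltaPd = some eD)
    (hUd : E .Udd = some eUd) (hUp : E .Upp = some eUp) (s : Fin 4 → ℝ) (ρ : ℝ) {m : ℝ}
    (hm : ∀ i : Fin 4, m ≤ emeryEnergyDensity (emeryLine s
      (lowerCorner (emeryLo εp eA eB eD eUd eUp) (emeryHi εp eA eB eD eUd eUp) i)) ρ) :
    HoldsOn (fun p : EmeryCoord → ℝ => m ≤ emeryEnergyDensity (emeryLine s (emeryLineCoords (εp : ℝ) p)) ρ) E :=
  holdsOn_emeryEnergyFloor_lowerFace hA hB hD hUd hUp s ρ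
    (forall_mem_piFinset_lowerFace (P := fun v => m ≤ emeryEnergyDensity (emeryLine s v) ρ) hm)

/-! ## §2 The composed door: four cluster certificates ⇒ the floor on the whole six-box -/

/-- **FOUR CLUSTER CERTIFICATES BIND THE SIX-BOX (uniform weight).** Fix a sign pattern `s`, a cell filling `ρ` with a nonempty class, a finite
window `B ⊆ ℤ²` containing an even translate of every interacting rooted shape of the three-band interaction (at every coupling vector), and a
mass `M > 0`. If at each lower-face corner `θ_i = emeryLine s (lowerCorner lo hi i)` an operator `G_i ∈ 𝔄_B` killed by `2×2`-periodic states and a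
level `q₀ i` with `H^{w}_B[emeryInteraction θ_i] + G_i − q₀ i·1 ⪰ 0` (uniform `(2ℤ)²`-weight of mass `M`) are given, then every `m ≤ q₀ i/(4M)`
(`i = 0,…,3`) is a floor `m ≤ e(emeryLine s q, ρ)` on ALL of `Set.Icc lo hi`. [cite: Anderson1951, eq. (2)] [cite: Israel1979, Thm. I.3.4] -/
theorem le_emeryEnergyDensity_line_of_cornerCertificates (s : Fin 4 → ℝ) {ρ : ℝ} (hS : (emeryStates ρ).Nonempty)
    (lo hi : Fin 6 → ℝ) (B : Finset (Site 2)) {M : ℝ} (hM : 0 < M)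
    (hfit : ∀ (θ : Fin 14 → ℝ) (c : Cell liebPeriods) (X : Finset (Site 2)), cellPos c ∈ X → (emeryInteraction θ).Φ X ≠ 0 →
      ∃ v : Site 2, InCoset liebPeriods 0 v ∧ shiftSet v X ⊆ B)
    (G : Fin 4 → FermionOp B) (hG0 : ∀ i, ∀ ω' : InfVolFermionState 2, ω'.IsPeriodic liebPeriods → (ω'.expect B (G i)).re = 0)
    (q₀ : Fin 4 → ℝ)
    (hq : ∀ i : Fin 4, ((⟨fun X => (uniformPeriodicWeight liebPeriods B M X : ℂ) •
        (emeryInteraction (emeryLine s (lowerCorner lo hi i))).Φ X⟩ : FermionInteraction 2).localHamiltonian B +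
        G i - (q₀ i : ℂ) • (1 : FermionOp B)).PosSemidef)
    {m : ℝ} (hm : ∀ i : Fin 4, m ≤ q₀ i / (4 * M)) {q : Fin 6 → ℝ} (hq' : q ∈ Set.Icc lo hi) :
    m ≤ emeryEnergyDensity (emeryLine s q) ρ :=
  le_emeryEnergyDensity_line_of_lowerCorners s ρ lo hi
    (fun i => (hm i).trans (InfVolFermionState.le_emeryEnergyDensity_of_posSemidef_uniform _ hS B hM (hfit _) (hG0 i) (hq i))) hq'

/-- **FOUR CLUSTER CERTIFICATES BIND THE SIX-BOX (any admissible weight).** As `le_emeryEnergyDensity_line_of_cornerCertificates` with a general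
`L_{(2,2)}`-admissible weight `w` of mass `M` (admissibility checked at each corner's interaction) and the levels corrected by the empty-shape term:
`m ≤ (q₀ i − w ∅ · (Ψ_i ∅)_{∅∅})/(4M)` for each `i` ⇒ `m ≤ e(emeryLine s q, ρ)` on `Set.Icc lo hi`. [cite: ValentiStolzeHirschfeld1991, §II] [cite: Israel1979, Thm. I.3.4] -/
theorem le_emeryEnergyDensity_line_of_cornerCertificates_reweight (s : Fin 4 → ℝ) {ρ : ℝ} (hS : (emeryStates ρ).Nonempty)
    (lo hi : Fin 6 → ℝ) (B : Finset (Site 2)) (w : Finset (Site 2) → ℝ) {M : ℝ} (hM : 0 < M)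
    (hw : ∀ (i : Fin 4) (c : Cell liebPeriods) (X : Finset (Site 2)), cellPos c ∈ X →
      (emeryInteraction (emeryLine s (lowerCorner lo hi i))).Φ X ≠ 0 →
      ∑ y ∈ B with (InfVolFermionState.cellRes liebPeriods y = c ∧ shiftSet (y - cellPos c) X ⊆ B), w (shiftSet (y - cellPos c) X) = M)
    (G : Fin 4 → FermionOp B) (hG0 : ∀ i, ∀ ω' : InfVolFermionState 2, ω'.IsPeriodic liebPeriods → (ω'.expect B (G i)).re = 0)
    (q₀ : Fin 4 → ℝ)
    (hq : ∀ i : Fin 4, ((⟨fun X => (w X : ℂ) • (emeryInteraction (emeryLine s (lowerCorner lo hi i))).Φ X⟩ : FermionInteraction 2).localHamiltonian B +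
        G i - (q₀ i : ℂ) • (1 : FermionOp B)).PosSemidef)
    {m : ℝ} (hm : ∀ i : Fin 4, m ≤ (q₀ i - w ∅ * (((emeryInteraction (emeryLine s (lowerCorner lo hi i))).Φ ∅) ∅ ∅).re) / (4 * M))
    {q : Fin 6 → ℝ} (hq' : q ∈ Set.Icc lo hi) :
    m ≤ emeryEnergyDensity (emeryLine s q) ρ :=
  le_emeryEnergyDensity_line_of_lowerCorners s ρ lo hi
    (fun i => (hm i).trans (InfVolFermionState.le_emeryEnergyDensity_of_posSemidef_reweight _ hS B w hM (hw i) (hG0 i) (hq i))) hq'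

/-- **THE COMPOSED DOOR: four cluster certificates ⇒ the typed 3BE floor word.** For a typed Emery box `E` with entries `t_pd, t_pp, Delta_pd, U_dd,
U_pp`, reference level `εp`, sign pattern `s`, cell filling `ρ` (nonempty class), a window `B` with the covering property, mass `M > 0`, and at each of
the four corners `θ_i = emeryLine s (lowerCorner (emeryLo εp …) (emeryHi εp …) i)` a certificate `H^{w}_B[emeryInteraction θ_i] + G_i − q₀ i·1 ⪰ 0`
(uniform weight): every `m ≤ min_i q₀ i/(4M)` is the box word `p ↦ m ≤ e(emeryLine s (emeryLineCoords εp p), ρ)` on `E`.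
[cite: Anderson1951, eq. (2)] [cite: Israel1979, Thm. I.3.4] -/
theorem holdsOn_emeryEnergyFloor_of_cornerCertificates {E : EmeryBox} {eA eB eD eUd eUp : Entry} {εp : ℚ}
    (hA : E .tpd = some eA) (hB : E .tpp = some eB) (hD : E .DeltaPd = some eD)
    (hUd : E .Udd = some eUd) (hUp : E .Upp = some eUp) (s : Fin 4 → ℝ) {ρ : ℝ} (hS : (emeryStates ρ).Nonempty)
    (B : Finset (Site 2)) {M : ℝ} (hM : 0 < M)
    (hfit : ∀ (θ : Fin 14 → ℝ) (c : Cell liebPeriods) (X : Finset (Site 2)), cellPos c ∈ X → (emeryInteraction θ).Φ X ≠ 0 →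
      ∃ v : Site 2, InCoset liebPeriods 0 v ∧ shiftSet v X ⊆ B)
    (G : Fin 4 → FermionOp B) (hG0 : ∀ i, ∀ ω' : InfVolFermionState 2, ω'.IsPeriodic liebPeriods → (ω'.expect B (G i)).re = 0)
    (q₀ : Fin 4 → ℝ)
    (hq : ∀ i : Fin 4, ((⟨fun X => (uniformPeriodicWeight liebPeriods B M X : ℂ) •
        (emeryInteraction (emeryLine s (lowerCorner (emeryLo εp eA eB eD eUd eUp) (emeryHi εp eA eB eD eUd eUp) i))).Φ X⟩ :
        FermionInteraction 2).localHamiltonian B + G i - (q₀ i : ℂ) • (1 : FermionOp B)).PosSemidef)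
    {m : ℝ} (hm : ∀ i : Fin 4, m ≤ q₀ i / (4 * M)) :
    HoldsOn (fun p : EmeryCoord → ℝ => m ≤ emeryEnergyDensity (emeryLine s (emeryLineCoords (εp : ℝ) p)) ρ) E :=
  holdsOn_emeryEnergyFloor_of_lowerCorners hA hB hD hUd hUp s ρ
    (fun i => (hm i).trans (InfVolFermionState.le_emeryEnergyDensity_of_posSemidef_uniform _ hS B hM (hfit _) (hG0 i) (hq i)))

/-! ## §3 ORDER SHEET for box #18 La₂CuO₄ (`emeryBoxLa214v122`, §OF-RECORD v1.22, `εp = 0`) -/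

/-- **The four corners an S2 device must certify for La₂CuO₄'s 3BE floor** (order `(t_pd, t_pp, ε_d, ε_p, U_d, U_p)`, eV, `εp = 0`):
`(129/100, 23/50, 17/10, 0, 483/100, 17/5)`, `(38/25, 23/50, …)`, `(129/100, 33/50, …)`, `(38/25, 33/50, …)` — `t_pd ∈ {1.29, 1.52}`,
`t_pp ∈ {0.46, 0.66}`, `ε_d = Δ_lo = 1.7`, `ε_p = 0`, `U_d = 4.83`, `U_p = 3.4`. SCREENING-GRADE ends (box #18). [folklore] -/
def la214v122Corner : Fin 4 → Fin 6 → ℝ :=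
  ![![129/100, 23/50, 17/10, 0, 483/100, 17/5], ![38/25, 23/50, 17/10, 0, 483/100, 17/5],
    ![129/100, 33/50, 17/10, 0, 483/100, 17/5], ![38/25, 33/50, 17/10, 0, 483/100, 17/5]]

/-- The order sheet IS the lower-corner list of `emeryBoxLa214v122`'s delivered six-box. [folklore] -/
theorem la214v122_lowerCorner :
    lowerCorner (emeryLo 0 la214Emery_tpd la214Emery_tpp la214Emery_Delta la214Emery_Udd_v122 la214Emery_Upp_v118)
      (emeryHi 0 la214Emery_tpd la214Emery_tpp la214Emery_Delta la214Emery_Udd_v122 la214Emery_Upp_v118) = la214v122Corner := by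
  rw [la214v122_emeryLo, la214v122_emeryHi]
  ext i k
  fin_cases i <;> fin_cases k <;> simp [lowerCorner, la214v122Corner]

/-- The coupling vector at corner `i` for sign pattern `s`: `emeryLine s (la214v122Corner i) =
![t, t, t, t, s₀ t', s₁ t', s₂ t', s₃ t', 17/10, 0, 0, 483/100, 17/5, 17/5]` with `(t, t') = (la214v122Corner i 0, la214v122Corner i 1)`. [cite: PavariniEtAl2001, eq. (1)] -/
theorem emeryLine_la214v122Corner (s : Fin 4 → ℝ) (i : Fin 4) :
    emeryLine s (la214v122Corner i) = ![la214v122Corner i 0, la214v122Corner i 0, la214v122Corner i 0, la214v122Corner i 0,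
      s 0 * la214v122Corner i 1, s 1 * la214v122Corner i 1, s 2 * la214v122Corner i 1, s 3 * la214v122Corner i 1,
      17/10, 0, 0, 483/100, 17/5, 17/5] := by
  ext a
  fin_cases i <;> fin_cases a <;> simp [emeryLine, la214v122Corner]

/-- **La₂CuO₄: four corner floors ⇒ the 3BE floor word on `emeryBoxLa214v122`** (device-free form: the four floors however obtained).
[cite: Israel1979, Thm. I.3.4] -/
theorem emeryBoxLa214v122_energyFloor_of_lowerCorners (s : Fin 4 → ℝ) (ρ : ℝ) {m : ℝ}
    (hm : ∀ i : Fin 4, m ≤ emeryEnergyDensity (emeryLine s (la214v122Corner i)) ρ) :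
    HoldsOn (fun p : EmeryCoord → ℝ => m ≤ emeryEnergyDensity (emeryLine s (emeryLineCoords 0 p)) ρ) emeryBoxLa214v122 := by
  have h := holdsOn_emeryEnergyFloor_of_lowerCorners (E := emeryBoxLa214v122) (εp := 0) (eA := la214Emery_tpd) (eB := la214Emery_tpp)
    (eD := la214Emery_Delta) (eUd := la214Emery_Udd_v122) (eUp := la214Emery_Upp_v118) rfl rfl rfl rfl rfl s ρ (m := m)
    (by rw [la214v122_lowerCorner]; exact hm)
  simpa using h

/-- **La₂CuO₄ ORDER SHEET ⇒ WORD: four Cu–O cluster certificates at `emeryLine s (la214v122Corner i)` give the 3BE floor word on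
`emeryBoxLa214v122`** (uniform weight on one window `B`; cell filling of record `ρ = 5/4` by `emeryBoxLa214v122_cellFilling`, any `ρ` with a nonempty
class admitted). [cite: Anderson1951, eq. (2)] [cite: Israel1979, Thm. I.3.4] -/
theorem emeryBoxLa214v122_energyFloor_of_cornerCertificates (s : Fin 4 → ℝ) {ρ : ℝ} (hS : (emeryStates ρ).Nonempty)
    (B : Finset (Site 2)) {M : ℝ} (hM : 0 < M)
    (hfit : ∀ (θ : Fin 14 → ℝ) (c : Cell liebPeriods) (X : Finset (Site 2)), cellPos c ∈ X → (emeryInteraction θ).Φ X ≠ 0 →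
      ∃ v : Site 2, InCoset liebPeriods 0 v ∧ shiftSet v X ⊆ B)
    (G : Fin 4 → FermionOp B) (hG0 : ∀ i, ∀ ω' : InfVolFermionState 2, ω'.IsPeriodic liebPeriods → (ω'.expect B (G i)).re = 0)
    (q₀ : Fin 4 → ℝ)
    (hq : ∀ i : Fin 4, ((⟨fun X => (uniformPeriodicWeight liebPeriods B M X : ℂ) •
        (emeryInteraction (emeryLine s (la214v122Corner i))).Φ X⟩ : FermionInteraction 2).localHamiltonian B +
        G i - (q₀ i : ℂ) • (1 : FermionOp B)).PosSemidef)
    {m : ℝ} (hm : ∀ i : Fin 4, m ≤ q₀ i / (4 * M)) :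
    HoldsOn (fun p : EmeryCoord → ℝ => m ≤ emeryEnergyDensity (emeryLine s (emeryLineCoords 0 p)) ρ) emeryBoxLa214v122 :=
  emeryBoxLa214v122_energyFloor_of_lowerCorners s ρ
    (fun i => (hm i).trans (InfVolFermionState.le_emeryEnergyDensity_of_posSemidef_uniform _ hS B hM (hfit _) (hG0 i) (hq i)))

/-! ## §4 Density-resolved floors: certificates at μ-TILTED corners (the filling enters through the couplings)

A cluster certificate knows no filling; the filling `ρ` enters by tilting the three site energies together: a certificate at
`θ + μ·levelDir` (`levelDir = e₈ + e₉ + e₁₀`, `EmeryReferenceLevel`) bounds `e(θ + μ·levelDir, ρ) = e(θ, ρ) + μρ`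
(`emeryEnergyDensity_add_levelShift`), i.e. gives `q₀/(4M) − μρ ≤ e(θ, ρ)`; the producer scans `μ` and keeps the best. The doors of
§2–§3 with each corner certificate taken at its own tilt `μ i`. -/

/-- **One tilted certificate** (uniform weight): `H^{w}_B[emeryInteraction (θ + μ·levelDir)] + G − q₀·1 ⪰ 0` gives
`q₀/(4M) − μ·ρ ≤ e(θ, ρ)`. [cite: Anderson1951, eq. (2)] [cite: BratteliKishimotoRobinson1978, Thm. 2 (condition 2)] -/
theorem le_emeryEnergyDensity_of_posSemidef_uniform_levelShift (θ : Fin 14 → ℝ) {ρ : ℝ} (hS : (emeryStates ρ).Nonempty)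
    (B : Finset (Site 2)) {M : ℝ} (hM : 0 < M)
    (hfit : ∀ (θ : Fin 14 → ℝ) (c : Cell liebPeriods) (X : Finset (Site 2)), cellPos c ∈ X → (emeryInteraction θ).Φ X ≠ 0 →
      ∃ v : Site 2, InCoset liebPeriods 0 v ∧ shiftSet v X ⊆ B)
    {G : FermionOp B} (hG0 : ∀ ω' : InfVolFermionState 2, ω'.IsPeriodic liebPeriods → (ω'.expect B G).re = 0) (μ q₀ : ℝ)
    (hq : ((⟨fun X => (uniformPeriodicWeight liebPeriods B M X : ℂ) • (emeryInteraction (θ + μ • levelDir)).Φ X⟩ :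
        FermionInteraction 2).localHamiltonian B + G - (q₀ : ℂ) • (1 : FermionOp B)).PosSemidef) :
    q₀ / (4 * M) - μ * ρ ≤ emeryEnergyDensity θ ρ := by
  have h := InfVolFermionState.le_emeryEnergyDensity_of_posSemidef_uniform (θ + μ • levelDir) hS B hM (hfit _) hG0 hq
  rw [emeryEnergyDensity_add_levelShift hS] at h
  linarith

/-- **FOUR TILTED CLUSTER CERTIFICATES BIND THE SIX-BOX.** Certificates `q₀ i` at `emeryLine s (lowerCorner lo hi i) + μ i·levelDir`
(`i : Fin 4`, uniform weight on one window) give `m ≤ e(emeryLine s q, ρ)` on ALL of `Set.Icc lo hi` for every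
`m ≤ min_i (q₀ i/(4M) − μ i·ρ)`. [cite: Anderson1951, eq. (2)] [cite: Israel1979, Thm. I.3.4] -/
theorem le_emeryEnergyDensity_line_of_tiltedCornerCertificates (s : Fin 4 → ℝ) {ρ : ℝ} (hS : (emeryStates ρ).Nonempty)
    (lo hi : Fin 6 → ℝ) (B : Finset (Site 2)) {M : ℝ} (hM : 0 < M)
    (hfit : ∀ (θ : Fin 14 → ℝ) (c : Cell liebPeriods) (X : Finset (Site 2)), cellPos c ∈ X → (emeryInteraction θ).Φ X ≠ 0 →
      ∃ v : Site 2, InCoset liebPeriods 0 v ∧ shiftSet v X ⊆ B)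
    (G : Fin 4 → FermionOp B) (hG0 : ∀ i, ∀ ω' : InfVolFermionState 2, ω'.IsPeriodic liebPeriods → (ω'.expect B (G i)).re = 0)
    (μ q₀ : Fin 4 → ℝ)
    (hq : ∀ i : Fin 4, ((⟨fun X => (uniformPeriodicWeight liebPeriods B M X : ℂ) •
        (emeryInteraction (emeryLine s (lowerCorner lo hi i) + μ i • levelDir)).Φ X⟩ : FermionInteraction 2).localHamiltonian B +
        G i - (q₀ i : ℂ) • (1 : FermionOp B)).PosSemidef)
    {m : ℝ} (hm : ∀ i : Fin 4, m ≤ q₀ i / (4 * M) - μ i * ρ) {q : Fin 6 → ℝ} (hq' : q ∈ Set.Icc lo hi) :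
    m ≤ emeryEnergyDensity (emeryLine s q) ρ :=
  le_emeryEnergyDensity_line_of_lowerCorners s ρ lo hi
    (fun i => (hm i).trans (le_emeryEnergyDensity_of_posSemidef_uniform_levelShift _ hS B hM hfit (hG0 i) (μ i) (q₀ i) (hq i))) hq'

/-- **THE COMPOSED DOOR, density-resolved form: four tilted cluster certificates ⇒ the typed 3BE floor word** on a typed Emery box `E`
(entries `t_pd, t_pp, Delta_pd, U_dd, U_pp`, reference level `εp`): every `m ≤ min_i (q₀ i/(4M) − μ i·ρ)` is the box word
`p ↦ m ≤ e(emeryLine s (emeryLineCoords εp p), ρ)`. [cite: Anderson1951, eq. (2)] [cite: Israel1979, Thm. I.3.4] -/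
theorem holdsOn_emeryEnergyFloor_of_tiltedCornerCertificates {E : EmeryBox} {eA eB eD eUd eUp : Entry} {εp : ℚ}
    (hA : E .tpd = some eA) (hB : E .tpp = some eB) (hD : E .DeltaPd = some eD)
    (hUd : E .Udd = some eUd) (hUp : E .Upp = some eUp) (s : Fin 4 → ℝ) {ρ : ℝ} (hS : (emeryStates ρ).Nonempty)
    (B : Finset (Site 2)) {M : ℝ} (hM : 0 < M)
    (hfit : ∀ (θ : Fin 14 → ℝ) (c : Cell liebPeriods) (X : Finset (Site 2)), cellPos c ∈ X → (emeryInteraction θ).Φ X ≠ 0 →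
      ∃ v : Site 2, InCoset liebPeriods 0 v ∧ shiftSet v X ⊆ B)
    (G : Fin 4 → FermionOp B) (hG0 : ∀ i, ∀ ω' : InfVolFermionState 2, ω'.IsPeriodic liebPeriods → (ω'.expect B (G i)).re = 0)
    (μ q₀ : Fin 4 → ℝ)
    (hq : ∀ i : Fin 4, ((⟨fun X => (uniformPeriodicWeight liebPeriods B M X : ℂ) •
        (emeryInteraction (emeryLine s (lowerCorner (emeryLo εp eA eB eD eUd eUp) (emeryHi εp eA eB eD eUd eUp) i) +
          μ i • levelDir)).Φ X⟩ : FermionInteraction 2).localHamiltonian B + G i - (q₀ i : ℂ) • (1 : FermionOp B)).PosSemidef)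
    {m : ℝ} (hm : ∀ i : Fin 4, m ≤ q₀ i / (4 * M) - μ i * ρ) :
    HoldsOn (fun p : EmeryCoord → ℝ => m ≤ emeryEnergyDensity (emeryLine s (emeryLineCoords (εp : ℝ) p)) ρ) E :=
  holdsOn_emeryEnergyFloor_of_lowerCorners hA hB hD hUd hUp s ρ
    (fun i => (hm i).trans (le_emeryEnergyDensity_of_posSemidef_uniform_levelShift _ hS B hM hfit (hG0 i) (μ i) (q₀ i) (hq i)))

/-- **La₂CuO₄, density-resolved: four tilted Cu–O cluster certificates at `emeryLine s (la214v122Corner i) + μ i·levelDir` give the 3BE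
floor word on `emeryBoxLa214v122`** (cell filling of record `ρ = 5/4`). [cite: Anderson1951, eq. (2)] [cite: Israel1979, Thm. I.3.4] -/
theorem emeryBoxLa214v122_energyFloor_of_tiltedCornerCertificates (s : Fin 4 → ℝ) {ρ : ℝ} (hS : (emeryStates ρ).Nonempty)
    (B : Finset (Site 2)) {M : ℝ} (hM : 0 < M)
    (hfit : ∀ (θ : Fin 14 → ℝ) (c : Cell liebPeriods) (X : Finset (Site 2)), cellPos c ∈ X → (emeryInteraction θ).Φ X ≠ 0 →
      ∃ v : Site 2, InCoset liebPeriods 0 v ∧ shiftSet v X ⊆ B)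
    (G : Fin 4 → FermionOp B) (hG0 : ∀ i, ∀ ω' : InfVolFermionState 2, ω'.IsPeriodic liebPeriods → (ω'.expect B (G i)).re = 0)
    (μ q₀ : Fin 4 → ℝ)
    (hq : ∀ i : Fin 4, ((⟨fun X => (uniformPeriodicWeight liebPeriods B M X : ℂ) •
        (emeryInteraction (emeryLine s (la214v122Corner i) + μ i • levelDir)).Φ X⟩ : FermionInteraction 2).localHamiltonian B +
        G i - (q₀ i : ℂ) • (1 : FermionOp B)).PosSemidef)
    {m : ℝ} (hm : ∀ i : Fin 4, m ≤ q₀ i / (4 * M) - μ i * ρ) :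
    HoldsOn (fun p : EmeryCoord → ℝ => m ≤ emeryEnergyDensity (emeryLine s (emeryLineCoords 0 p)) ρ) emeryBoxLa214v122 :=
  emeryBoxLa214v122_energyFloor_of_lowerCorners s ρ
    (fun i => (hm i).trans (le_emeryEnergyDensity_of_posSemidef_uniform_levelShift _ hS B hM hfit (hG0 i) (μ i) (q₀ i) (hq i)))

/-! ## §5 Turnkey on the `CuO₄` plus window: no covering hypothesis left -/

/-- **TURNKEY: four tilted `CuO₄` certificates ⇒ the typed 3BE floor word.** On the plus window `emeryCuO4Window` (Cu + its four O; `4⁵`-dimensional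
Fock space) the covering hypothesis is discharged for every coupling vector (`emeryCuO4Window_fit`), so four uniform-weight certificates `q₀ i` at
`emeryLine s (lowerCorner (emeryLo εp …) (emeryHi εp …) i) + μ i·levelDir` give the box word `p ↦ m ≤ e(emeryLine s (emeryLineCoords εp p), ρ)` on the
typed box `E` for every `m ≤ min_i (q₀ i/(4M) − μ i·ρ)` — nothing assumed but the certificates and the nonempty class.
[cite: Anderson1951, eq. (2)] [cite: Israel1979, Thm. I.3.4] -/
theorem holdsOn_emeryEnergyFloor_of_cuO4Certificates {E : EmeryBox} {eA eB eD eUd eUp : Entry} {εp : ℚ}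
    (hA : E .tpd = some eA) (hB : E .tpp = some eB) (hD : E .DeltaPd = some eD)
    (hUd : E .Udd = some eUd) (hUp : E .Upp = some eUp) (s : Fin 4 → ℝ) {ρ : ℝ} (hS : (emeryStates ρ).Nonempty) {M : ℝ} (hM : 0 < M)
    (G : Fin 4 → FermionOp emeryCuO4Window)
    (hG0 : ∀ i, ∀ ω' : InfVolFermionState 2, ω'.IsPeriodic liebPeriods → (ω'.expect emeryCuO4Window (G i)).re = 0)
    (μ q₀ : Fin 4 → ℝ)
    (hq : ∀ i : Fin 4, ((⟨fun X => (uniformPeriodicWeight liebPeriods emeryCuO4Window M X : ℂ) •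
        (emeryInteraction (emeryLine s (lowerCorner (emeryLo εp eA eB eD eUd eUp) (emeryHi εp eA eB eD eUd eUp) i) +
          μ i • levelDir)).Φ X⟩ : FermionInteraction 2).localHamiltonian emeryCuO4Window + G i -
        (q₀ i : ℂ) • (1 : FermionOp emeryCuO4Window)).PosSemidef)
    {m : ℝ} (hm : ∀ i : Fin 4, m ≤ q₀ i / (4 * M) - μ i * ρ) :
    HoldsOn (fun p : EmeryCoord → ℝ => m ≤ emeryEnergyDensity (emeryLine s (emeryLineCoords (εp : ℝ) p)) ρ) E :=
  holdsOn_emeryEnergyFloor_of_tiltedCornerCertificates hA hB hD hUd hUp s hS emeryCuO4Window hM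
    (fun θ => emeryCuO4Window_fit θ) G hG0 μ q₀ hq hm

/-- **La₂CuO₄ TURNKEY: four tilted `CuO₄` certificates at `emeryLine s (la214v122Corner i) + μ i·levelDir` ⇒ the 3BE floor word on
`emeryBoxLa214v122`** (ρ of record `5/4`; corners `(1.29 | 1.52, 0.46 | 0.66, 1.7, 0, 4.83, 3.4)` eV). [cite: Anderson1951, eq. (2)] [cite: Israel1979, Thm. I.3.4] -/
theorem emeryBoxLa214v122_energyFloor_of_cuO4Certificates (s : Fin 4 → ℝ) {ρ : ℝ} (hS : (emeryStates ρ).Nonempty) {M : ℝ} (hM : 0 < M)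
    (G : Fin 4 → FermionOp emeryCuO4Window)
    (hG0 : ∀ i, ∀ ω' : InfVolFermionState 2, ω'.IsPeriodic liebPeriods → (ω'.expect emeryCuO4Window (G i)).re = 0)
    (μ q₀ : Fin 4 → ℝ)
    (hq : ∀ i : Fin 4, ((⟨fun X => (uniformPeriodicWeight liebPeriods emeryCuO4Window M X : ℂ) •
        (emeryInteraction (emeryLine s (la214v122Corner i) + μ i • levelDir)).Φ X⟩ : FermionInteraction 2).localHamiltonian emeryCuO4Window +
        G i - (q₀ i : ℂ) • (1 : FermionOp emeryCuO4Window)).PosSemidef)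
    {m : ℝ} (hm : ∀ i : Fin 4, m ≤ q₀ i / (4 * M) - μ i * ρ) :
    HoldsOn (fun p : EmeryCoord → ℝ => m ≤ emeryEnergyDensity (emeryLine s (emeryLineCoords 0 p)) ρ) emeryBoxLa214v122 :=
  emeryBoxLa214v122_energyFloor_of_tiltedCornerCertificates s hS emeryCuO4Window hM (fun θ => emeryCuO4Window_fit θ) G hG0 μ q₀ hq hm

end Summit.Ventures.CertifiedManyBodySolver.Downfold

end
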